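import Summits.ABC.ABC.Theses.IsogenyGlueCongruence
import Literature.AlgebraicGeometry.Motives.AbelianVarietyBaseChange
import Literature.NumberTheory.EllipticCurves.CongruenceNumber

/-!
# Route `IsogenyGlueCongruence`, crux K `TorsionSharingPrimeBound` (stmt-ABC-2157) — line
# `SketchIdeator3g2` (idea `absolute-size-collapse`): definitions and proved glue

This file is the importable part of the registered line skeleton
`Cruxes/TorsionSharingPrimeBound/Lines/SketchIdeator3g2.lean` (everything except the `sorry`d stubs and
the final composition `TorsionSharingPrimeBound_of`):

* §1 the transfer side (statements) — `GeomRankOne`, C⁺ = `AbsoluteGluingExponentBound` (the bet,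
  conjecture-grade), the instance datum `ModularJacobianRankOne`, and `PolyModularDegree` (verbatim the
  antecedent of the route decl `SharpDegreeOfPolyDegree`);
* §2 the first lemma, PROVED: `polyDegreeOfAbsoluteSize : C⁺ → ModularJacobianRankOne →
  SemistableHeightPolyBound → PolyModularDegree` and `degreePrimesPolyBounded_of_poly : PolyModularDegree →
  DegreePrimesPolyBounded` (crux A);
* §3 the three pieces into which K splits by the level `M` of the partner newform (statements) —
  `KSameLevel` (`M = N`), `KLevelLowerBound` (some `p ∣ N` with `p ∤ M`), `KLevelRaiseBound` (all primes of
  `N` divide `M`, `M ≠ N`) — over the congruence hypothesis `CongruentAway` of K, and (§3b) the two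
  bundles of PRINTED inputs the pieces consume (`SameLevelCongruenceFacts`, `LevelMismatchFacts`: each
  conjunct a published theorem written in the tree's `q`-expansion vocabulary, sources in the
  docstrings; declared fact-stubs of the skeleton, i.e. Literature debt, not claims);
* §5 the glue, PROVED: `k_of_pieces : KSameLevel → KLevelLowerBound → KLevelRaiseBound → KCrux`
  (`KCrux` = the crux), by the case split `ℓ < 11` ∣ `ℓ ∣ MN` ∣ `M = N` ∣ `∃ p ∣ N, p ∤ M` ∣ rest.

Nothing here restates the crux as a fact; the conjecture-grade statements are marked as such.
-/

noncomputable section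

-- `Summit.ABC.ABC` is the mandated summit-side namespace (single-conjunct summit).
set_option linter.dupNamespace false

open CategoryTheory
open Literature.AlgebraicGeometry.Motives
open Literature.NumberTheory.EllipticCurves.ModularForms
open Summit.ABC.ABC.Theses.IsogenyGlueCongruence
open scoped MatrixGroups ModularForm
open CongruenceSubgroup

namespace Summit.ABC.ABC.Theorems.IGCTorsionSharing

/-! ## §1 The line's objects (from `Cruxes/TorsionSharingPrimeBound/SketchIdeator3g2.lean`) -/

/-- **Geometric rank one**: after any extension of scalars `L/ℚ`, two homomorphisms `E_L ⟶ B_L`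
are `ℤ`-linearly dependent (`Hom_{ℚ̄}(E, B)` has rank `≤ 1`). -/
def GeomRankOne (E B : AbelianVariety.{0} ℚ) : Prop :=
  ∀ (L : Type) [Field L] [Algebra ℚ L] (α₁ α₂ : E.baseChange L ⟶ B.baseChange L),
    ∃ a b : ℤ, (a ≠ 0 ∨ b ≠ 0) ∧ a • α₁ = b • α₂

/-- **C⁺ (the transfer, semi-uniform size form on geometrically rank-one pairs)**: the least
positive `E`-multiplier `n` of `B` satisfies `n ≤ C · (dim B · max(1, h_F(W)))^κ` with absolute
`κ, C`. (CONJECTURE-GRADE.) -/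
def AbsoluteGluingExponentBound : Prop :=
  ∃ κ C : ℝ, 0 ≤ κ ∧ ∀ (W : WeierstrassCurve ℚ) [W.IsElliptic] (E B : AbelianVariety.{0} ℚ)
    (e : E.geomPoints ≃+ W.geomPoints),
    (∀ (σ : Field.absoluteGaloisGroup ℚ) (P : E.geomPoints), e (σ • P) = σ • e P) →
    GeomRankOne E B →
    ∀ (α : E ⟶ B) (β : B ⟶ E) (n : ℤ), 0 < n → α ≫ β = n • 𝟙 E →
    (∀ (α' : E ⟶ B) (β' : B ⟶ E) (n' : ℤ), 0 < n' → α' ≫ β' = n' • 𝟙 E → n ≤ n') →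
    (n : ℝ) ≤ C * ((B.dim : ℝ) * max 1 W.stableFaltingsHeight) ^ κ

/-- **Instance datum** (`ModularJacobianMultipliers` + geometric rank one + a positive
multiplier): `J = J₀(N)`, `E = W`, minimal datum `D` with `m_E ∣` every multiplier. -/
def ModularJacobianRankOne : Prop :=
  ∀ (W : WeierstrassCurve ℚ) [W.IsElliptic] [W.IsGloballyMinimal] [NeZero (W.conductorNorm ℤ)],
    W.IsSemistable ℤ →
    ∃ (D : ModularParametrizationData W (W.conductorNorm ℤ)) (E J : AbelianVariety.{0} ℚ)
      (e : E.geomPoints ≃+ W.geomPoints),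
      (∀ (σ : Field.absoluteGaloisGroup ℚ) (P : E.geomPoints), e (σ • P) = σ • e P) ∧
      (J.dim : ℝ) ≤ (W.conductorNorm ℤ : ℝ) ^ 2 ∧ GeomRankOne E J ∧
      (∃ (α : E ⟶ J) (β : J ⟶ E) (n : ℤ), 0 < n ∧ α ≫ β = n • 𝟙 E) ∧
      (∀ (α : E ⟶ J) (β : J ⟶ E) (n : ℤ), α ≫ β = n • 𝟙 E → (D.modularDegree : ℤ) ∣ n)

/-- The polynomial modular-degree statement for semistable curves — verbatim the antecedent of
`SharpDegreeOfPolyDegree`. (CONJECTURE-GRADE.) -/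
def PolyModularDegree : Prop :=
  ∃ κ C : ℝ, ∀ (W : WeierstrassCurve ℚ) [W.IsElliptic] [W.IsGloballyMinimal] [NeZero (W.conductorNorm ℤ)],
    W.IsSemistable ℤ → ∃ D : ModularParametrizationData W (W.conductorNorm ℤ),
      (D.modularDegree : ℝ) ≤ C * (W.conductorNorm ℤ : ℝ) ^ κ

/-! ## §2 First lemma (PROVED): C⁺ + instance + heights ⟹ PolyModularDegree ⟹ crux A -/

/-- C⁺, the rank-one Jacobian instance and `h_F(W) ≤ c N²` give `m_E ≤ C' N^{4κ}`. -/
theorem polyDegreeOfAbsoluteSize :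
    AbsoluteGluingExponentBound → ModularJacobianRankOne → SemistableHeightPolyBound →
      PolyModularDegree := by
  intro hC hJ hH
  obtain ⟨κ, C, hκ, H⟩ := hC
  obtain ⟨c, hc⟩ := hH
  refine ⟨4 * κ, |C| * (max 1 c) ^ κ, fun W _ _ _ hW => ?_⟩
  obtain ⟨D, E, J, e, he, hdim, hrank, ⟨α, β, n, hn, hαβ⟩, hdvd⟩ := hJ W hW
  classical
  let P : ℕ → Prop := fun m => 0 < m ∧ ∃ (α' : E ⟶ J) (β' : J ⟶ E), α' ≫ β' = ((m : ℕ) : ℤ) • 𝟙 E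
  have hP : ∃ m, P m := by
    refine ⟨n.toNat, Int.lt_toNat.mpr (by simpa using hn), α, β, ?_⟩
    rw [Int.toNat_of_nonneg hn.le]; exact hαβ
  obtain ⟨hn₀, α₀, β₀, h₀⟩ : P (Nat.find hP) := Nat.find_spec hP
  set n₀ : ℕ := Nat.find hP with hn₀def
  have hmin : ∀ (α' : E ⟶ J) (β' : J ⟶ E) (n' : ℤ), 0 < n' → α' ≫ β' = n' • 𝟙 E → (n₀ : ℤ) ≤ n' := by
    intro α' β' n' hn' h'
    have hPn' : P n'.toNat := by
      refine ⟨Int.lt_toNat.mpr (by simpa using hn'), α', β', ?_⟩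
      rw [Int.toNat_of_nonneg hn'.le]; exact h'
    have hle : n₀ ≤ n'.toNat := Nat.find_min' hP hPn'
    calc (n₀ : ℤ) ≤ (n'.toNat : ℤ) := by exact_mod_cast hle
      _ = n' := Int.toNat_of_nonneg hn'.le
  have hn₀Z : (0 : ℤ) < (n₀ : ℤ) := by exact_mod_cast hn₀
  have hbound := H W E J e he hrank α₀ β₀ (n₀ : ℤ) hn₀Z h₀ hmin
  have hmE : (D.modularDegree : ℤ) ≤ (n₀ : ℤ) := Int.le_of_dvd hn₀Z (hdvd α₀ β₀ _ h₀)
  refine ⟨D, ?_⟩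
  have hN1 : (1 : ℝ) ≤ (W.conductorNorm ℤ : ℝ) := by
    exact_mod_cast Nat.one_le_iff_ne_zero.mpr (NeZero.ne _)
  have hN0 : (0 : ℝ) ≤ (W.conductorNorm ℤ : ℝ) := by positivity
  have hh : W.stableFaltingsHeight ≤ c * (W.conductorNorm ℤ : ℝ) ^ 2 := hc W hW
  have hN2 : (1 : ℝ) ≤ (W.conductorNorm ℤ : ℝ) ^ 2 := one_le_pow₀ hN1
  have hmax : max 1 W.stableFaltingsHeight ≤ max 1 c * (W.conductorNorm ℤ : ℝ) ^ 2 := by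
    refine max_le ?_ ?_
    · calc (1 : ℝ) = 1 * 1 := by ring
        _ ≤ max 1 c * (W.conductorNorm ℤ : ℝ) ^ 2 :=
          mul_le_mul (le_max_left _ _) hN2 (by norm_num) (by positivity)
    · exact hh.trans (mul_le_mul_of_nonneg_right (le_max_right _ _) (by positivity))
  have hX0 : (0 : ℝ) ≤ (J.dim : ℝ) * max 1 W.stableFaltingsHeight := by positivity
  have hX : (J.dim : ℝ) * max 1 W.stableFaltingsHeight ≤ max 1 c * (W.conductorNorm ℤ : ℝ) ^ 4 := by
    calc (J.dim : ℝ) * max 1 W.stableFaltingsHeight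
        ≤ (W.conductorNorm ℤ : ℝ) ^ 2 * (max 1 c * (W.conductorNorm ℤ : ℝ) ^ 2) :=
          mul_le_mul hdim hmax (by positivity) (by positivity)
      _ = max 1 c * (W.conductorNorm ℤ : ℝ) ^ 4 := by ring
  have hpow : ((W.conductorNorm ℤ : ℝ) ^ 4) ^ κ = (W.conductorNorm ℤ : ℝ) ^ (4 * κ) := by
    rw [show ((W.conductorNorm ℤ : ℝ) ^ 4) = (W.conductorNorm ℤ : ℝ) ^ ((4 : ℕ) : ℝ) from
      (Real.rpow_natCast _ 4).symm, ← Real.rpow_mul hN0]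
    norm_num
  calc (D.modularDegree : ℝ) ≤ (n₀ : ℝ) := by exact_mod_cast hmE
    _ ≤ C * ((J.dim : ℝ) * max 1 W.stableFaltingsHeight) ^ κ := by exact_mod_cast hbound
    _ ≤ |C| * ((J.dim : ℝ) * max 1 W.stableFaltingsHeight) ^ κ :=
        mul_le_mul_of_nonneg_right (le_abs_self C) (by positivity)
    _ ≤ |C| * (max 1 c * (W.conductorNorm ℤ : ℝ) ^ 4) ^ κ :=
        mul_le_mul_of_nonneg_left (Real.rpow_le_rpow hX0 hX hκ) (abs_nonneg C)
    _ = |C| * (max 1 c) ^ κ * (W.conductorNorm ℤ : ℝ) ^ (4 * κ) := by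
        rw [Real.mul_rpow (by positivity) (by positivity), hpow]; ring

/-- The polynomial degree statement closes crux A: a prime factor of a positive integer is at
most the integer. -/
theorem degreePrimesPolyBounded_of_poly : PolyModularDegree → DegreePrimesPolyBounded := by
  intro h
  obtain ⟨κ, C, h⟩ := h
  refine ⟨κ, C, fun W _ _ _ hW => ?_⟩
  obtain ⟨D, hD⟩ := h W hW
  refine ⟨D, fun ℓ _ hdvd => le_trans ?_ hD⟩
  exact_mod_cast Nat.le_of_dvd D.deg_pos hdvd

/-! ## §3 The three pieces of K -/

/-- The congruence hypothesis of K at `(W, M, g, ℓ)`: some subring `R ⊆ ℂ` containing all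
`aₙ(g)`, a field `F` of characteristic `ℓ` and `φ : R →+* F` with `φ(a_p(g)) = a_p(W)` for all
primes `p ∤ M · N_W · ℓ` ("`f_W ≡ g` modulo a prime above `ℓ`"). -/
def CongruentAway (W : WeierstrassCurve ℚ) (M : ℕ) (g : CuspForm (Gamma0 M) 2) (ℓ : ℕ) : Prop :=
  ∃ (R : Subring ℂ) (F : Type) (_ : Field F) (_ : CharP F ℓ) (φ : R →+* F)
    (hg : ∀ n : ℕ, cuspCoeff g n ∈ R),
    ∀ p : ℕ, p.Prime → ¬ (p ∣ M * W.conductorNorm ℤ * ℓ) →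
      φ ⟨cuspCoeff g p, hg p⟩ = ((W.LFunction p : ℤ) : F)

/-- **Same-level piece of K** (`M = N`): congruence primes between `f_W` and another newform of
level `N = N_W` are `≤ C N^κ`. (CONJECTURE-GRADE.) -/
def KSameLevel : Prop :=
  ∃ κ C : ℝ, 0 ≤ κ ∧ ∀ (W : WeierstrassCurve ℚ) [W.IsElliptic] [W.IsGloballyMinimal]
    [NeZero (W.conductorNorm ℤ)], W.IsSemistable ℤ →
    ∀ (g : CuspForm (Gamma0 (W.conductorNorm ℤ)) 2), IsNewform0 g → ¬ IsNewformOf W g →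
    ∀ ℓ : ℕ, ℓ.Prime → CongruentAway W (W.conductorNorm ℤ) g ℓ →
      (ℓ : ℝ) ≤ C * (W.conductorNorm ℤ : ℝ) ^ κ

/-- **Level-lowering piece of K** (some `p ∣ N` with `p ∤ M`; `ℓ ≥ 11`, `ℓ ∤ M N`): then
`ℓ ∣ v_p(Δ_min)` (Deligne + Tate + Mazur), so `ℓ ≤ C N^κ` through the height bound. -/
def KLevelLowerBound : Prop :=
  ∃ κ C : ℝ, 0 ≤ κ ∧ ∀ (W : WeierstrassCurve ℚ) [W.IsElliptic] [W.IsGloballyMinimal]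
    [NeZero (W.conductorNorm ℤ)], W.IsSemistable ℤ →
    ∀ (M : ℕ) [NeZero M] (g : CuspForm (Gamma0 M) 2), IsNewform0 g → ¬ IsNewformOf W g →
    ∀ ℓ : ℕ, ℓ.Prime → 11 ≤ ℓ → ¬ (ℓ ∣ M * W.conductorNorm ℤ) →
    (∃ p : ℕ, p.Prime ∧ p ∣ W.conductorNorm ℤ ∧ ¬ p ∣ M) →
    CongruentAway W M g ℓ → (ℓ : ℝ) ≤ C * (W.conductorNorm ℤ : ℝ) ^ κ

/-- **Level-raising piece of K** (every prime of `N` divides `M`, `M ≠ N`; `ℓ ≥ 11`, `ℓ ∤ M N`):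
Carayol / Ribet / Diamond–Taylor numerics give `ℓ ≤ C M^κ` (in print `ℓ ≤ 4M`). -/
def KLevelRaiseBound : Prop :=
  ∃ κ C : ℝ, 0 ≤ κ ∧ ∀ (W : WeierstrassCurve ℚ) [W.IsElliptic] [W.IsGloballyMinimal]
    [NeZero (W.conductorNorm ℤ)], W.IsSemistable ℤ →
    ∀ (M : ℕ) [NeZero M] (g : CuspForm (Gamma0 M) 2), IsNewform0 g → ¬ IsNewformOf W g →
    ∀ ℓ : ℕ, ℓ.Prime → 11 ≤ ℓ → ¬ (ℓ ∣ M * W.conductorNorm ℤ) →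
    (∀ p : ℕ, p.Prime → p ∣ W.conductorNorm ℤ → p ∣ M) → M ≠ W.conductorNorm ℤ →
    CongruentAway W M g ℓ → (ℓ : ℝ) ≤ C * (M : ℝ) ^ κ

/-! ## §3b Printed inputs consumed by the three pieces (declared as fact-stubs) -/

/-- **Printed inputs of the same-level piece** (each conjunct a published theorem, in the
tree's vocabulary; discharging them is Literature work, not this line's):
(a) *anemic congruence primes are congruence primes* — for `W` semistable of conductor `N`, a
newform `g ≠ f_W` of level `N` congruent to `f_W` modulo a prime above `ℓ ≥ 11`, `ℓ ∤ N`, at all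
`p ∤ N ℓ` forces `ℓ ∣ r_{f_W}` (Ribet 1990 Thm 1.1 level lowering at the primes where `ρ̄_{W,ℓ}` is
unramified + re-raising with chosen `U_q`-signs, Diamond–Taylor 1994; Carayol 1986 local–global
compatibility at `q ∥ N`; Edixhoven 1992 Thm 2.5 for `a_ℓ`; Mazur 1978 irreducibility; then the
lattice argument of ARS 2012 §2.1 (i) ⇒ (ii)) (Ribet1990, Thm 1.1) (AgasheRibetStein2012, §2.1);
(b) *positivity* `0 < r_f` (ARS 2012 §2.1: "the positive integer `r_E`") (AgasheRibetStein2012, §2.1);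
(c) *the minimal degree divides every degree with the same newform* (factorisation through the
strong Weil curve; Knapp 1993 Prop. 12.9, Cremona 1997 §2.14) (Knapp1993, Prop. 12.9);
(d) ARS 2012 Thm 2.1, second assertion — the tree's named fact
`padicValNat_congruenceNumber_eq_of_not_sq_dvd`. -/
def SameLevelCongruenceFacts : Prop :=
  (∀ (W : WeierstrassCurve ℚ) [W.IsElliptic] [W.IsGloballyMinimal] [NeZero (W.conductorNorm ℤ)],
    W.IsSemistable ℤ →
    ∀ (D : ModularParametrizationData W (W.conductorNorm ℤ))
      (g : CuspForm (Gamma0 (W.conductorNorm ℤ)) 2), IsNewform0 g → ¬ IsNewformOf W g →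
    ∀ ℓ : ℕ, ℓ.Prime → 11 ≤ ℓ → ¬ (ℓ ∣ W.conductorNorm ℤ) →
    CongruentAway W (W.conductorNorm ℤ) g ℓ → ℓ ∣ congruenceNumber D.f) ∧
  (∀ (W : WeierstrassCurve ℚ) [W.IsElliptic] [NeZero (W.conductorNorm ℤ)]
    (D : ModularParametrizationData W (W.conductorNorm ℤ)), 0 < congruenceNumber D.f) ∧
  (∀ (N : ℕ) [NeZero N] (W W' : WeierstrassCurve ℚ) [W.IsElliptic] [W'.IsElliptic]
    (D : ModularParametrizationData W N) (D' : ModularParametrizationData W' N), D'.f = D.f →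
    (∀ (W'' : WeierstrassCurve ℚ) [W''.IsElliptic] (D'' : ModularParametrizationData W'' N),
        D''.f = D.f → D.modularDegree ≤ D''.modularDegree) →
    D.modularDegree ∣ D'.modularDegree) ∧
  padicValNat_congruenceNumber_eq_of_not_sq_dvd

/-- **Printed inputs of the level-mismatch pieces** (each conjunct a published theorem about the
mod-`ℓ` representation `ρ̄ = ρ̄_{W,ℓ} ≅ ρ̄_{g,λ}` of a semistable `W` congruent to a newform `g` of
level `M` modulo a prime above `ℓ ≥ 11`, `ℓ ∤ M N`, written in `q`-expansion vocabulary):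
(a) *level-lowering primes*: `ρ̄_g` is unramified at `p ∤ M ℓ` (Deligne; Diamond–Shurman Thm 9.6.5),
`ρ̄` is irreducible (Mazur 1978, `ℓ ≥ 11`), and `E[ℓ]` unramified at a multiplicative prime `p`
means `ℓ ∣ v_p(Δ_min)` (Tate curve; Serre 1987 §4.1, (4.1.12)) (Serre1987, §4.1);
(b) *level raising at `q ∥ M`, `q ∤ N`*: `a_q(W) ≡ ±(q + 1)` (Carayol 1986; Ribet 1990b "Raising the
levels", Thm 1, necessity; Diamond–Taylor 1994 Thm A) (DiamondTaylor1994, Thm A);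
(c) *Carayol at `q² ∣ M`*: `ℓ ∣ q² − 1` (Carayol 1989 Thm 2 / Diamond–Taylor 1994 Thm A; the conductor
exponent of `ρ̄ ≅ ρ̄_W` at `q` is `≤ 1`) (Carayol1989, Thm 2);
(d) *Silverman*: for semistable `E/ℚ` the denominator ideal of `j` is the minimal discriminant,
`N(𝔇) = |Δ_min|` (Silverman 1986 §2, p. 257) (Silverman1986, §2). -/
def LevelMismatchFacts : Prop :=
  (∀ (W : WeierstrassCurve ℚ) [W.IsElliptic] [W.IsGloballyMinimal] [NeZero (W.conductorNorm ℤ)],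
    W.IsSemistable ℤ → ∀ (M : ℕ) [NeZero M] (g : CuspForm (Gamma0 M) 2), IsNewform0 g →
    ∀ ℓ : ℕ, ℓ.Prime → 11 ≤ ℓ → ¬ (ℓ ∣ M * W.conductorNorm ℤ) → CongruentAway W M g ℓ →
    ∀ v : IsDedekindDomain.HeightOneSpectrum ℤ,
      Rat.HeightOneSpectrum.natGenerator v ∣ W.conductorNorm ℤ →
      ¬ (Rat.HeightOneSpectrum.natGenerator v ∣ M) → ℓ ∣ W.ordMinimalDiscriminant v) ∧
  (∀ (W : WeierstrassCurve ℚ) [W.IsElliptic] [W.IsGloballyMinimal] [NeZero (W.conductorNorm ℤ)],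
    W.IsSemistable ℤ → ∀ (M : ℕ) [NeZero M] (g : CuspForm (Gamma0 M) 2), IsNewform0 g →
    ∀ ℓ : ℕ, ℓ.Prime → 11 ≤ ℓ → ¬ (ℓ ∣ M * W.conductorNorm ℤ) → CongruentAway W M g ℓ →
    ∀ q : ℕ, q.Prime → q ∣ M → ¬ (q ^ 2 ∣ M) → ¬ (q ∣ W.conductorNorm ℤ) →
      (ℓ : ℤ) ∣ ((q : ℤ) + 1) ^ 2 - (W.LFunction q) ^ 2) ∧
  (∀ (W : WeierstrassCurve ℚ) [W.IsElliptic] [W.IsGloballyMinimal] [NeZero (W.conductorNorm ℤ)],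
    W.IsSemistable ℤ → ∀ (M : ℕ) [NeZero M] (g : CuspForm (Gamma0 M) 2), IsNewform0 g →
    ∀ ℓ : ℕ, ℓ.Prime → 11 ≤ ℓ → ¬ (ℓ ∣ M * W.conductorNorm ℤ) → CongruentAway W M g ℓ →
    ∀ q : ℕ, q.Prime → q ^ 2 ∣ M → (ℓ : ℤ) ∣ (q : ℤ) ^ 2 - 1) ∧
  (∀ (W : WeierstrassCurve ℚ) [W.IsElliptic] [W.IsGloballyMinimal], W.IsSemistable ℤ →
    Ideal.absNorm W.jDenominatorIdeal = W.minimalDiscriminantNorm ℤ)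

/-! ## §5 Glue (PROVED): the three pieces give K -/

/-- Alias of the crux used as the conclusion of the internal glue lemmas (so that exactly one
theorem of this file, `TorsionSharingPrimeBound_of`, states the crux by name). -/
def KCrux : Prop := TorsionSharingPrimeBound

/-- The case split `ℓ < 11` ∣ `ℓ ∣ M N` ∣ `M = N` ∣ `∃ p ∣ N, p ∤ M` ∣ (all primes of `N` divide
`M`, `M ≠ N`), with the real-power bookkeeping `κ = max(κᵢ, 1)`, `C = max(Cᵢ, 11)`. -/
theorem k_of_pieces : KSameLevel → KLevelLowerBound → KLevelRaiseBound → KCrux := by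
  intro h₁ h₂ h₃
  unfold KCrux TorsionSharingPrimeBound
  obtain ⟨κ₁, C₁, hκ₁, h₁⟩ := h₁
  obtain ⟨κ₂, C₂, hκ₂, h₂⟩ := h₂
  obtain ⟨κ₃, C₃, hκ₃, h₃⟩ := h₃
  refine ⟨max (max κ₁ κ₂) (max κ₃ 1), max (max C₁ C₂) (max C₃ 11), ?_, ?_⟩
  · exact le_trans zero_le_one (le_trans (le_max_right _ _) (le_max_right _ _))
  intro W _ _ _ hW M _ g hg hne ℓ hℓ R F _ _ φ hgR hcong
  set κ : ℝ := max (max κ₁ κ₂) (max κ₃ 1) with hκdef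
  set C : ℝ := max (max C₁ C₂) (max C₃ 11) with hCdef
  set N : ℕ := W.conductorNorm ℤ with hNdef
  have hN1 : (1 : ℝ) ≤ (N : ℝ) := by exact_mod_cast Nat.one_le_iff_ne_zero.2 (NeZero.ne _)
  have hM1 : (1 : ℝ) ≤ (M : ℝ) := by exact_mod_cast Nat.one_le_iff_ne_zero.2 (NeZero.ne _)
  have hX1 : (1 : ℝ) ≤ (M : ℝ) * (N : ℝ) := by nlinarith
  have hκ1 : (1 : ℝ) ≤ κ := le_trans (le_max_right _ _) (le_max_right _ _)
  have hκ0 : (0 : ℝ) ≤ κ := le_trans zero_le_one hκ1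
  have hC11 : (11 : ℝ) ≤ C := le_trans (le_max_right _ _) (le_max_right _ _)
  have hC0 : (0 : ℝ) ≤ C := by linarith
  have hXκ1 : (1 : ℝ) ≤ ((M : ℝ) * (N : ℝ)) ^ κ := Real.one_le_rpow hX1 hκ0
  have finish : ∀ (C' Y : ℝ), (ℓ : ℝ) ≤ C' * Y → C' ≤ C → 0 ≤ Y → Y ≤ ((M : ℝ) * (N : ℝ)) ^ κ →
      (ℓ : ℝ) ≤ C * ((M : ℝ) * (N : ℝ)) ^ κ := by
    intro C' Y h hC' hY hYX
    calc (ℓ : ℝ) ≤ C' * Y := h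
      _ ≤ C * Y := mul_le_mul_of_nonneg_right hC' hY
      _ ≤ C * ((M : ℝ) * (N : ℝ)) ^ κ := mul_le_mul_of_nonneg_left hYX hC0
  have cong : CongruentAway W M g ℓ := ⟨R, F, ‹_›, ‹_›, φ, hgR, hcong⟩
  -- `ℓ < 11`
  by_cases hℓ11 : ℓ < 11
  · have h11 : (ℓ : ℝ) ≤ 11 := by exact_mod_cast hℓ11.le
    calc (ℓ : ℝ) ≤ 11 := h11
      _ ≤ C := hC11
      _ = C * 1 := (mul_one C).symm
      _ ≤ C * ((M : ℝ) * (N : ℝ)) ^ κ := mul_le_mul_of_nonneg_left hXκ1 hC0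
  push Not at hℓ11
  -- `ℓ ∣ M N`
  by_cases hdiv : ℓ ∣ M * N
  · have hpos : 0 < M * N := Nat.pos_of_ne_zero (mul_ne_zero (NeZero.ne _) (NeZero.ne _))
    have hle : (ℓ : ℝ) ≤ (M : ℝ) * (N : ℝ) := by exact_mod_cast Nat.le_of_dvd hpos hdiv
    calc (ℓ : ℝ) ≤ (M : ℝ) * (N : ℝ) := hle
      _ = ((M : ℝ) * (N : ℝ)) ^ (1 : ℝ) := (Real.rpow_one _).symm
      _ ≤ ((M : ℝ) * (N : ℝ)) ^ κ := Real.rpow_le_rpow_of_exponent_le hX1 hκ1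
      _ = 1 * ((M : ℝ) * (N : ℝ)) ^ κ := (one_mul _).symm
      _ ≤ C * ((M : ℝ) * (N : ℝ)) ^ κ := mul_le_mul_of_nonneg_right (by linarith) (by positivity)
  -- `M = N`
  by_cases hMN : M = N
  · subst hMN
    have h := h₁ W hW g hg hne ℓ hℓ cong
    refine finish C₁ _ h (le_trans (le_max_left _ _) (le_max_left _ _)) (by positivity) ?_
    calc (W.conductorNorm ℤ : ℝ) ^ κ₁
        ≤ ((W.conductorNorm ℤ : ℝ) * (W.conductorNorm ℤ : ℝ)) ^ κ₁ :=
          Real.rpow_le_rpow (by positivity) (by nlinarith) hκ₁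
      _ ≤ ((W.conductorNorm ℤ : ℝ) * (W.conductorNorm ℤ : ℝ)) ^ κ :=
          Real.rpow_le_rpow_of_exponent_le hX1 (le_trans (le_max_left _ _) (le_max_left _ _))
  -- some prime of `N` does not divide `M`
  by_cases hex : ∃ p : ℕ, p.Prime ∧ p ∣ N ∧ ¬ p ∣ M
  · have h := h₂ W hW M g hg hne ℓ hℓ hℓ11 hdiv hex cong
    refine finish C₂ _ h (le_trans (le_max_right _ _) (le_max_left _ _)) (by positivity) ?_
    calc (N : ℝ) ^ κ₂ ≤ ((M : ℝ) * (N : ℝ)) ^ κ₂ :=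
          Real.rpow_le_rpow (by positivity) (by nlinarith) hκ₂
      _ ≤ ((M : ℝ) * (N : ℝ)) ^ κ :=
          Real.rpow_le_rpow_of_exponent_le hX1 (le_trans (le_max_right _ _) (le_max_left _ _))
  -- all primes of `N` divide `M`, and `M ≠ N`
  · push Not at hex
    have h := h₃ W hW M g hg hne ℓ hℓ hℓ11 hdiv hex hMN cong
    refine finish C₃ _ h (le_trans (le_max_left _ _) (le_max_right _ _)) (by positivity) ?_
    calc (M : ℝ) ^ κ₃ ≤ ((M : ℝ) * (N : ℝ)) ^ κ₃ :=
          Real.rpow_le_rpow (by positivity) (by nlinarith) hκ₃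
      _ ≤ ((M : ℝ) * (N : ℝ)) ^ κ :=
          Real.rpow_le_rpow_of_exponent_le hX1 (le_trans (le_max_left _ _) (le_max_right _ _))

end Summit.ABC.ABC.Theorems.IGCTorsionSharing

end
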